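import Literature.Analysis.FluidPDE.Tao2016AveragedNS.LocalCascadeSolutions

/-!
# `WakeRatchet.EternalViscousRate` (stmt-NavierStokesRegularity-25647): the SEEDED GRADED TODA TABLE of the
# tree's perpetual pump lies in Tao's class `E₂(2/ε)` — brick 4a of the bridge «`PerpetualPump.CircuitPump`
# witness ⟹ dissipation-balanced block-DSS bounded admissible eternal solution»

The instance behind `PerpetualPumpCircuitPump.CircuitPump_proof` is the m = 2 seeded graded Toda circuit
(`PerpetualPumpCircuitPumpClockBoxTable`: same-scale bond `(1,1,0,none) = -1`, `(1,0,1,none) = (0,1,1,none) = ½`;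
cross-scale bond `(1,1,0,e₃) = 1`, `(1,0,1,e₂) = (0,1,1,e₁) = -½`; seed `(0,0,1,none) = ε`,
`(0,1,0,none) = (1,0,0,none) = -ε/2`; all other entries `0`).  Pulled back to Tao's shift set `S ⊂ ℤ³` by the
dictionary of `WakeRatchetCircuitPumpTable` (`none ↦ (0,0,0)`, `e₁ ↦ (1,0,0)`, `e₂ ↦ (0,1,0)`, `e₃ ↦ (0,0,1)`), it is
the table written out explicitly below, and this file checks BY CASES that for `0 < ε ≤ 1` it is symmetric (4.2),
cancelling (4.3) and `(2/ε)`-comparable: `InTableClass (2/ε)` (`todaTable_inTableClass`).  So the pump's table IS a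
member of the WakeRatchet class `E₂(R)` — with spread `R = 2/ε(lam)` that diverges as the scale ratio `lam ↓ 1`
(`ε(lam) = e^{-Λ(lam)}`, `Λ ≥ 10⁵(log A₂ + 500)`, `A₂ ≍ Λ/(lam^{1/5} - 1)` in `PerpetualPumpCircuitPumpClockBoxEps`),
which is why the witness bears on the `R`-UNIFORMITY of the threshold `εs(R)` of `EternalViscousRate` and not on
the crux at fixed `R`.  (Zero-padding to `m = 4` preserves all three properties; not done here.)
HONEST LABEL: finite algebra about a MODEL lattice table (Tao 2016 §4); no item is closed; nothing here bears on
the Navier–Stokes equations.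
-/

noncomputable section

set_option linter.dupNamespace false

namespace Summit.NavierStokesRegularity.NavierStokesRegularity.Theorems

namespace WakeRatchetCircuitPumpTodaClass

open Literature.Analysis.FluidPDE Literature.Analysis.FluidPDE.TaoCascade

/-- Every element of `Fin 2` is `0` or `1`. [folklore] -/
private theorem fin_two_eq_zero_or_one (x : Fin 2) : x = 0 ∨ x = 1 := by
  fin_cases x <;> simp

/-- **The seeded graded Toda table is in `E₂(2/ε)`** (`0 < ε ≤ 1`): Tao's symmetry (4.2), cancellation (4.3) and
`(2/ε)`-comparability (`|α| ≤ 1`, non-zero entries `≥ ε/2`) for the pulled-back table of the perpetual pump.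
[cite: Tao2016AveragedNS, §4 (4.2)–(4.3), §6.1 (comparable tables); cell vocabulary (`InTableClass`)] -/
theorem todaTable_inTableClass (ε : ℝ) (hε : 0 < ε) (hε1 : ε ≤ 1) :
    InTableClass (2 / ε) (fun (i₁ i₂ i₃ : Fin 2) (μ : ℤ × ℤ × ℤ) =>
      if μ = (0, 0, 0) then
        (if i₁ = 1 ∧ i₂ = 1 ∧ i₃ = 0 then (-1 : ℝ) else if i₁ = 1 ∧ i₂ = 0 ∧ i₃ = 1 then 1 / 2
          else if i₁ = 0 ∧ i₂ = 1 ∧ i₃ = 1 then 1 / 2 else if i₁ = 0 ∧ i₂ = 0 ∧ i₃ = 1 then ε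
          else if i₁ = 0 ∧ i₂ = 1 ∧ i₃ = 0 then -ε / 2 else if i₁ = 1 ∧ i₂ = 0 ∧ i₃ = 0 then -ε / 2 else 0)
      else if μ = (1, 0, 0) then (if i₁ = 0 ∧ i₂ = 1 ∧ i₃ = 1 then -1 / 2 else 0)
      else if μ = (0, 1, 0) then (if i₁ = 1 ∧ i₂ = 0 ∧ i₃ = 1 then -1 / 2 else 0)
      else if μ = (0, 0, 1) then (if i₁ = 1 ∧ i₂ = 1 ∧ i₃ = 0 then 1 else 0) else 0) := by
  have h2e : (2 / ε)⁻¹ = ε / 2 := by rw [inv_div]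
  have hA : ε / 2 ≤ 1 / 2 := by linarith
  have hB : ε / 2 ≤ 1 := by linarith
  have hC : ε / 2 ≤ ε := by linarith
  refine ⟨?_, ?_, ?_⟩
  · intro i₁ i₂ i₃ μ₁ μ₂ μ₃ hμ
    rw [mem_shiftSet_iff] at hμ
    rcases fin_two_eq_zero_or_one i₁ with rfl | rfl <;>
    rcases fin_two_eq_zero_or_one i₂ with rfl | rfl <;>
    rcases fin_two_eq_zero_or_one i₃ with rfl | rfl <;>
    rcases hμ with h | h | h | h <;> simp only [Prod.mk.injEq] at h <;> obtain ⟨rfl, rfl, rfl⟩ := h <;>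
    simp
  · intro i₁ i₂ i₃ μ₁ μ₂ μ₃ hμ
    rw [mem_shiftSet_iff] at hμ
    rcases fin_two_eq_zero_or_one i₁ with rfl | rfl <;>
    rcases fin_two_eq_zero_or_one i₂ with rfl | rfl <;>
    rcases fin_two_eq_zero_or_one i₃ with rfl | rfl <;>
    rcases hμ with h | h | h | h <;> simp only [Prod.mk.injEq] at h <;> obtain ⟨rfl, rfl, rfl⟩ := h <;>
    norm_num <;> ring
  · intro i₁ i₂ i₃ μ hμ
    rw [mem_shiftSet_iff] at hμ
    rw [h2e]
    rcases fin_two_eq_zero_or_one i₁ with rfl | rfl <;>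
    rcases fin_two_eq_zero_or_one i₂ with rfl | rfl <;>
    rcases fin_two_eq_zero_or_one i₃ with rfl | rfl <;>
    rcases hμ with rfl | rfl | rfl | rfl <;>
    norm_num [abs_of_pos hε, abs_div, hε.le, hε1, hA, hB, hC, hε.ne']
  
end WakeRatchetCircuitPumpTodaClass

end Summit.NavierStokesRegularity.NavierStokesRegularity.Theorems

end
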